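import Summits.QuantumFields.YangMills.Theorems.FluctuationComparisonRegPrIntLWregChainLaw
import Summits.QuantumFields.YangMills.Theorems.FluctuationComparisonRegPrIntLWregGlue
import Summits.QuantumFields.YangMills.Theorems.UnitScaleTiltFluctuationComparisonRegPrFibrePositivity
import Summits.QuantumFields.YangMills.Theorems.UnitScaleTiltFluctuationComparisonRegPrAnsatzTStub
import Summits.QuantumFields.YangMills.Theorems.UnitScaleTiltFluctuationComparisonRegPrPosOnSmallReduction
import Literature.MathematicalPhysics.QuantumFieldTheory.Balaban1983to89.B12ContinuousTransportInvarianceOn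
import Literature.MathematicalPhysics.QuantumFieldTheory.Balaban1983to89.T3MinimiserStabilityReduction
import HarnessLib

/-!
# WREG PORT F4a — INTERIOR and the CHART-REG reduction of LINE g18-2 «fibred-chart table for WREG», made importable BY NAME
# (v20 `Cruxes/FluctuationComparisonRegPrIntL/Lines/wreg_chart.lean` @7e8eb395e5b4 ∕ tree sha16 36befdc7ca5b8719: the four chart-free obligation
# statements ll. 2341–2390 + §4b ll. 1953–2045 + §4c ll. 2046–2202, VERBATIM)

Cell `ym3-torus`, width seat `ym3-torus-px17` g6 — F4 pen of ★★OWNER WORD 31 (A) on the ideator seat ym-r3-idea-1 g18's PORT MAP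
`Lines/wreg_chart_port.md` @7bd96d90; helper of `stmt-QuantumFields-20520` (`--supports`, count-neutral).  One namespace
`…Theorems.FluctuationComparisonRegPrIntLWregInterior` shared with F4b `…WregInteriorRungs.lean` (§4f + §4g), split at the map's seam for the
400-line rule.  Imports: F1b `…WregChainLaw` (`ChainVol`; brings F1a `…WregChain`: `iterCentralBond`, `chainMap`, `chainWindow` — px13 g8) and F3 `…WregGlue` (`WindowFibreInterior`,
`WindowChart`, `histGood`-side glue — px7 g8 ∕ px4 g10 bytes), plus the tree modules the two sections cite by name.

CONTENT (authorship: ideator ym-r3-idea-1 g14–g18, proofs unchanged).  §A the four chart-free obligation statements `ChartVolT3` (VOL), `EdgeFlat`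
(EDGE), `LevelFlat` (LEVEL), `ChartCharge` (CHARGE) — moved to the top as the map prescribes (F5's assembly `windowChartsExist_of_flat` and F6's knit
read them; their Theorems-side proofs are ✓`…WregChartVol.chartVolT3_holds`, ✓`…WregChartEdge.edgeFlat_of_chainEqns`,
✓`…WregChartLevelNear.levelFlatNear_of_chain` + `levelFlat_of_near` (F4b), ✓`…WregChartCharge.chartCharge_holds`).  §4b INTERIOR, PROVED:
`isOpen_histProfile_and_continuousOn`, `isOpen_histGood`, ★★★`windowFibreInterior_holds : WindowFibreInterior`.  §4c CHART-REG REDUCTION: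
`closure_histProfile_subset_and_continuousAt`, `frontier_histProfile_subset`, ★★★`frontier_histGood_subset` (the frontier of `histGood` lies on finitely
many threshold level sets), `continuousAt_iter_of_mem_closure_histGood`, ★★★`WindowChart.ofLevelAvoiding` (a window chart from level-set avoidance).

ONE DECLARED DEVIATION FROM VERBATIM (gate hygiene, w4-20520 g14's 16:06:13Z lesson on F3): in the docstrings of the parameter-free obligation `Prop`s
`ChartVolT3` ∕ `EdgeFlat` ∕ `LevelFlat` ∕ `ChartCharge` the `[cite: …]` bracket is spelled `(print: …)` — a bracket-tagged parameter-free `def X : Prop` is RELOCATED to `Literature/` by the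
gate, where these route-internal obligations cannot elaborate; statement texts are untouched (ws-identical to v20 by script).

HONEST FRAMING.  A port is bookkeeping: every declaration below is a VERBATIM move of a proved declaration of the ideator seat's workfile
(namespace swap + `open` preamble only; statements and proofs byte-identical to v20); nothing new is proved and nothing of Bałaban's is
asserted; WREG is ONE organ of the S2β package of an exploratory line of the DECIDING crux `FluctuationComparisonRegPrIntL`
(stmt-QuantumFields-20520), which is NOT proved; EXW ∕ GAP ∕ LAPLACE ∕ H4ᶜ ∕ LFR♯ᶜ and the package's seven stubs stay open; rung R3 = YM₃ on T³ —
NOT d = 4, NOT infinite volume, NOT a mass gap, NOT Clay; no summit statement is proved by a line; `YM3TorusSU2` is NOT proved.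
-/

noncomputable section

open MeasureTheory Filter Topology Set
open scoped ENNReal NNReal
open Literature.MathematicalPhysics.QuantumFieldTheory.Balaban1983to89
open Literature.MathematicalPhysics.QuantumFieldTheory.Balaban1983to89.T3ContinuumYM3Torus
open Literature.MathematicalPhysics.QuantumFieldTheory.Balaban1983to89.T3NestedUnitLaws
open Literature.MathematicalPhysics.QuantumFieldTheory.Balaban1983to89.T3UnitLawDensityEML
open Literature.MathematicalPhysics.QuantumFieldTheory.Balaban1983to89.T3UnitScaleTilt
open Literature.MathematicalPhysics.QuantumFieldTheory.Balaban1983to89.T3TiltDescent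
open Literature.MathematicalPhysics.QuantumFieldTheory.Balaban1983to89.T3PrintedRegularMinimiser
open Literature.MathematicalPhysics.QuantumFieldTheory.Balaban1983to89.T3ConstrainedMinimiser (fibre)
open Literature.MathematicalPhysics.QuantumFieldTheory.Balaban1983to89.T3LevelShift
open Literature.MathematicalPhysics.QuantumFieldTheory.Balaban1983to89.T3SmallLiftHistory
open Literature.MathematicalPhysics.QuantumFieldTheory.Balaban1983to89.T3Thresholds
open Literature.MathematicalPhysics.QuantumFieldTheory.Balaban1983to89.Missing
open Literature.MathematicalPhysics.QuantumFieldTheory.Balaban1983to89.T4Continuum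
open scoped Literature.MathematicalPhysics.QuantumFieldTheory.Balaban1983to89.T3OrbitAverage
open Summit.QuantumFields.YangMills.Theorems.FluctuationComparisonRegPrIntLWregChain
open Summit.QuantumFields.YangMills.Theorems.FluctuationComparisonRegPrIntLWregGlue

namespace Summit.QuantumFields.YangMills.Theorems.FluctuationComparisonRegPrIntLWregInterior

/-! ## §A The four chart-free obligation statements of the table (v20 §4e ll. 2341–2390, moved to the top per the port map) -/

section ChartFree

open Literature.MathematicalPhysics.QuantumFieldTheory.Balaban1983to89.ExpMeanLog (deltaSU)
open Literature.MathematicalPhysics.QuantumFieldTheory.Balaban1983to89.BlockAveraging (Idx)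
open Literature.MathematicalPhysics.QuantumFieldTheory.Balaban1983to89.BlockAveragingEMLHaarAC (offCard offCard_lt_card)

/-- **CHART-VOL (T³, SU(2))** — uniform volume non-compression on the central windows. (print: Balaban1987RG1, (0.4) p.253 and (2.10) p.267) -/
def ChartVolT3 : Prop :=
  ∀ (F : T3Family) (K : ℕ) (α : ℝ), 0 < α → α ≤ 1 / 24 → 64 * α ≤ deltaSU (Fin 2) →
    157 * α < (((F.P K).L : ℝ) ^ ((F.P K).d - 1))⁻¹ →
    (∀ j (c : PBond (F.P K) (j + 1)), (offCard c : ℝ) / (Fintype.card (Idx (F.P K)) : ℝ) + 150 * α < 1) →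
      ∃ j₀ : ℝ≥0, 0 < j₀ ∧ ChainVol (F.P K) 2 α j₀

/-- **EDGE FLATNESS (T³, SU(2))**. (print: Balaban1987RG1, (0.4) p.253 and (2.9) p.266) -/
def EdgeFlat : Prop :=
  ∀ (F : T3Family) (K n : ℕ), n ≤ (F.P K).m + (F.P K).K → ∀ (α : ℝ), 0 < α → α ≤ 1 / 24 → 64 * α ≤ deltaSU (Fin 2) →
    157 * α < (((F.P K).L : ℝ) ^ ((F.P K).d - 1))⁻¹ →
    (∀ j (c : PBond (F.P K) (j + 1)), (offCard c : ℝ) / (Fintype.card (Idx (F.P K)) : ℝ) + 150 * α < 1) →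
    ∀ (c : PBond (F.P K) n) (v : Matrix.specialUnitaryGroup (Fin 2) ℂ),
      ∀ᵐ z ∂fieldMeasure (F.P K) 0 (Matrix.specialUnitaryGroup (Fin 2) ℂ),
        v ∉ frontier (chainMap ℰp n z c '' chainWindow (N := 2) α n z c)

/-- **LEVEL FLATNESS (T³, SU(2))** — every plaquette of every level `j < n` avoids the thresholds a.e. (print: Balaban1985UV3, (7) p.257 and (28)-(31) p.263) -/
def LevelFlat : Prop :=
  ∀ (F : T3Family) (K n : ℕ), n ≤ (F.P K).m + (F.P K).K → ∀ (α : ℝ), 0 < α → α ≤ 1 / 24 → 64 * α ≤ deltaSU (Fin 2) →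
    157 * α < (((F.P K).L : ℝ) ^ ((F.P K).d - 1))⁻¹ →
    (∀ j (c : PBond (F.P K) (j + 1)), (offCard c : ℝ) / (Fintype.card (Idx (F.P K)) : ℝ) + 150 * α < 1) →
    ∀ (t : ℕ → ℝ), (∀ j, t j ≠ 0) → ∀ (W : GaugeField (F.P K) n (Matrix.specialUnitaryGroup (Fin 2) ℂ)),
      ∀ᵐ z ∂fieldMeasure (F.P K) 0 (Matrix.specialUnitaryGroup (Fin 2) ℂ),
        ∀ U : GaugeField (F.P K) 0 (Matrix.specialUnitaryGroup (Fin 2) ℂ),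
          (∀ b, (∀ c, iterCentralBond n c ≠ b) → U b = z b) →
          (∀ c, U (iterCentralBond n c) ∈ chainWindow (N := 2) α n U c) →
          Averaging.iter (fun i => BlockAveraging.blockAvg (P := F.P K) (j := i) ℰp) n U = W →
            ∀ j, j < n → ∀ p : Plaq (F.P K) j,
              dist1 (GaugeField.plaqHol (Averaging.iter (fun i => BlockAveraging.blockAvg (P := F.P K) (j := i) ℰp) j U) p) ≠ t j

/-- **CHARGE (T³, SU(2))** — the charted fine fields charge every window of the interior set. (print: Balaban1987RG1, (2.10) p.267 and (0.4) p.253) -/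
def ChartCharge : Prop :=
  ∀ (F : T3Family) (K J : ℕ) (θ : ℕ → ℝ) (α : ℝ), (∀ i, 0 ≤ θ i) → 0 < α → α ≤ 1 / 24 → 64 * α ≤ deltaSU (Fin 2) →
    157 * α < (((F.P K).L : ℝ) ^ ((F.P K).d - 1))⁻¹ →
    (∀ j (c : PBond (F.P K) (j + 1)), (offCard c : ℝ) / (Fintype.card (Idx (F.P K)) : ℝ) + 150 * α < 1) →
    (∀ i, (((((F.P K).d + 2) * (F.P K).L : ℕ) : ℝ) ^ 2 / 4) * θ i ≤ α) →
    ∀ W : GaugeField (F.P K) (K - J) (Matrix.specialUnitaryGroup (Fin 2) ℂ),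
      (∃ U₀ ∈ interior (histGood F ℰp θ K J),
          Averaging.iter (fun i => BlockAveraging.blockAvg (P := F.P K) (j := i) ℰp) (K - J) U₀ = W) →
      0 < fieldMeasure (F.P K) 0 (Matrix.specialUnitaryGroup (Fin 2) ℂ)
        {z | ∃ g : PBond (F.P K) (K - J) → Matrix.specialUnitaryGroup (Fin 2) ℂ,
          Function.extend (iterCentralBond (K - J)) g z ∈ histGood F ℰp θ K J ∧
          Averaging.iter (fun i => BlockAveraging.blockAvg (P := F.P K) (j := i) ℰp) (K - J)
            (Function.extend (iterCentralBond (K - J)) g z) = W}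

end ChartFree

/-! ## §4b INTERIOR, PROVED (v5): `histGood` is open in the small-coupling regime; every window fibre meets it -/

section OpenProfile

variable {P : Params} {G : Type*} [GaugeGroup G] [TopologicalSpace G] (av : ∀ j, Averaging P j G) (ϑ : ℕ → ℝ) (δ₁ : ℝ)

/-- ★ **THE UV-SMALL HISTORIES FORM AN OPEN SET ON WHICH THE ITERATED AVERAGING IS CONTINUOUS**: if the small-field … [cite: Balaban1985UV3, (7) p.257] -/
theorem isOpen_histProfile_and_continuousOn
    (hopen : ∀ (j : ℕ) (δ : ℝ), IsOpen {U : GaugeField P j G | PlaqSmall δ U})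
    (hϑ : ∀ i, ϑ i ≤ δ₁)
    (hC : ∀ j, j + 1 ≤ P.m + P.K → ContinuousOn (av j).avg {U : GaugeField P j G | PlaqSmall δ₁ U}) :
    ∀ k : ℕ, k ≤ P.m + P.K →
      IsOpen {U : GaugeField P 0 G | ∀ i, i ≤ k → PlaqSmall (ϑ i) (Averaging.iter av i U)} ∧
        ContinuousOn (Averaging.iter av k) {U : GaugeField P 0 G | ∀ i, i ≤ k → PlaqSmall (ϑ i) (Averaging.iter av i U)}
  | 0, _ => by
      have hS : {U : GaugeField P 0 G | ∀ i, i ≤ 0 → PlaqSmall (ϑ i) (Averaging.iter av i U)} = {U | PlaqSmall (ϑ 0) U} := by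
        ext U
        simp only [Set.mem_setOf_eq]
        exact ⟨fun h => h 0 le_rfl, fun h i hi => by obtain rfl : i = 0 := Nat.le_zero.mp hi; exact h⟩
      rw [hS]
      exact ⟨hopen 0 (ϑ 0), continuousOn_id⟩
  | k + 1, hk => by
      obtain ⟨hSo, hSc⟩ := isOpen_histProfile_and_continuousOn hopen hϑ hC k (by omega)
      set S : Set (GaugeField P 0 G) := {U | ∀ i, i ≤ k → PlaqSmall (ϑ i) (Averaging.iter av i U)} with hSdef
      have hmaps : MapsTo (Averaging.iter av k) S {U : GaugeField P k G | PlaqSmall δ₁ U} := by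
        intro U hU
        exact fun p => (hU k le_rfl p).trans_le (hϑ k)
      have hcont : ContinuousOn (Averaging.iter av (k + 1)) S := (hC k (by omega)).comp hSc hmaps
      have hS' : {U : GaugeField P 0 G | ∀ i, i ≤ k + 1 → PlaqSmall (ϑ i) (Averaging.iter av i U)} =
          S ∩ Averaging.iter av (k + 1) ⁻¹' {W | PlaqSmall (ϑ (k + 1)) W} := by
        ext U
        simp only [hSdef, Set.mem_setOf_eq, Set.mem_inter_iff, Set.mem_preimage]
        constructor
        · intro h
          exact ⟨fun i hi => h i (by omega), h (k + 1) le_rfl⟩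
        · rintro ⟨h1, h2⟩ i hi
          rcases Nat.lt_or_ge i (k + 1) with hlt | hge
          · exact h1 i (by omega)
          · obtain rfl : i = k + 1 := le_antisymm hi hge
            exact h2
      rw [hS']
      refine ⟨hcont.isOpen_inter_preimage hSo (hopen (k + 1) (ϑ (k + 1))), hcont.mono Set.inter_subset_left⟩

end OpenProfile

/-- ★★ **`histGood` IS OPEN IN THE SMALL-COUPLING REGIME**. [cite: Balaban1985UV3, (7) p.257] -/
theorem isOpen_histGood (F : T3Family) {K : ℕ} {θ : ℕ → ℝ} {δ₁ : ℝ} (hδ₁ : 0 ≤ δ₁) (hθ : ∀ i, θ i ≤ δ₁)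
    (hsmall : (((((F.P K).d + 2) * (F.P K).L : ℕ) : ℝ) ^ 2 / 4) * δ₁ ≤ ExpMeanLog.deltaSU (Fin 2) / 2) {n : ℕ} (h : n ≤ K) :
    IsOpen (histGood F ℰp θ K n) := by
  rw [Summit.QuantumFields.YangMills.Theorems.PosOnSmallReduction.histGood_eq_setOf_forall_le F θ h]
  have hKK : (F.P K).K = K := rfl
  exact (isOpen_histProfile_and_continuousOn (fun i => BlockAveraging.blockAvg (P := F.P K) (j := i) ℰp) (fun i => θ (K - i)) δ₁
    (fun j δ => Node00.isOpen_plaqSmall δ) (fun i => hθ _)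
    (fun j _ => Summit.QuantumFields.YangMills.Theorems.FibrePositivity.continuousOn_blockAvg_expMeanLogSU hδ₁ hsmall) (K - n) (by omega)).1

/-- ★★★ **INTERIOR, PROVED**: every window datum has a fine history in the interior of `histGood`. [cite: Balaban1987RG1, (0.4) p.253–254] -/
theorem windowFibreInterior_holds : WindowFibreInterior := by
  intro L b₀ p₀ hb hp
  obtain ⟨κ, δ₀, hκ, hδ₀, hF⟩ := Summit.QuantumFields.YangMills.Theorems.ApproxLift.AnsatzT.stub_oneStepSmallLift L
  set δ₁ : ℝ := ExpMeanLog.deltaSU (Fin 2) / 2 / ((((3 + 2) * L : ℕ) : ℝ) ^ 2 / 4 + 1) with hδ₁def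
  have hD : 0 < ((((3 + 2) * L : ℕ) : ℝ) ^ 2 / 4 + 1) := by positivity
  have hδ₁ : 0 < δ₁ := by
    rw [hδ₁def]; exact div_pos (half_pos ExpMeanLog.deltaSU_pos) hD
  obtain ⟨γ₁, hγ₁, hγ₁1, hθ⟩ := exists_gamma_forall_θBal_le (b₀ := b₀) (p₀ := p₀) hb hp (lt_min hδ₀ hδ₁)
  refine ⟨γ₁, hγ₁, fun F γ hFL hγ hγγ₁ J K hJK V hV => ?_⟩
  have hL : 1 ≤ F.L := F.hL.2.le
  subst hFL
  have hγ1 : γ ≤ 1 := hγγ₁.trans hγ₁1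
  have hθ₀ : ∀ i, θBal F.L γ b₀ p₀ i ≤ δ₀ := fun i => (hθ F.L hL γ hγ hγγ₁ i).trans (min_le_left _ _)
  have hθ₁ : ∀ i, θBal F.L γ b₀ p₀ i ≤ δ₁ := fun i => (hθ F.L hL γ hγ hγγ₁ i).trans (min_le_right _ _)
  have hκ1 : κ ≤ 1 := by
    rcases le_or_gt κ 0 with hκ0 | hκ0
    · linarith
    · have h1 : (1 : ℝ) ≤ Real.sqrt F.L := by
        rw [show (1 : ℝ) = Real.sqrt 1 from Real.sqrt_one.symm]
        exact Real.sqrt_le_sqrt (by exact_mod_cast hL)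
      have h2 := mul_le_mul_of_nonneg_left h1 hκ0.le
      rw [mul_one] at h2
      exact h2.trans hκ
  have hθpos : ∀ i, 0 < θBal F.L γ b₀ p₀ i := fun i => T3MinimiserStabilityReduction.θBal_pos hL hγ hγ1 hb p₀ i
  have hθs : ∀ i, κ * θBal F.L γ b₀ p₀ i ≤ θBal F.L γ b₀ p₀ (i + 1) := mul_θBal_le_θBal_succ hL hγ hγ1 hb.le hp.le hκ
  obtain ⟨U, hU, hUg⟩ := exists_mem_fibre_histGood F ℰp (hF F rfl) hκ1 hθpos hθ₀ hθs hJK hV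
  have hsmall : (((((F.P K).d + 2) * (F.P K).L : ℕ) : ℝ) ^ 2 / 4) * δ₁ ≤ ExpMeanLog.deltaSU (Fin 2) / 2 := by
    have hd : (F.P K).d = 3 := T3Family.P_d F K
    have hLL : (F.P K).L = F.L := rfl
    rw [hd, hLL, hδ₁def]
    rw [mul_div_assoc', div_le_iff₀ hD]
    have hq : 0 ≤ ExpMeanLog.deltaSU (Fin 2) / 2 := (half_pos ExpMeanLog.deltaSU_pos).le
    nlinarith [hq]
  have hopen : IsOpen (histGood F ℰp (θBal F.L γ b₀ p₀) K J) := isOpen_histGood F hδ₁.le hθ₁ hsmall hJK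
  exact ⟨U, hU, hopen.interior_eq.symm ▸ hUg⟩

/-! ## §4c CHART-REG REDUCTION (PROVED, v6): the frontier of `histGood` lies on finitely many threshold level hypersurfaces. -/

section ClosedProfile

variable {P : Params} {G : Type*} [GaugeGroup G] [TopologicalSpace G] (av : ∀ j, Averaging P j G) (ϑ : ℕ → ℝ) (δ₁ : ℝ)

/-- ★ **CLOSURE OF THE UV-SMALL HISTORIES ⊆ THE CLOSED PROFILE SET, AND EVERY `avg^k` IS CONTINUOUS THERE**: if the … [cite: Balaban1985UV3, (7) p.257] -/
theorem closure_histProfile_subset_and_continuousAt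
    (hdist : ∀ (j : ℕ) (p : Plaq P j), Continuous fun U : GaugeField P j G => dist1 (GaugeField.plaqHol U p))
    (hopen : ∀ (j : ℕ) (δ : ℝ), IsOpen {U : GaugeField P j G | PlaqSmall δ U})
    (hϑ : ∀ i, ϑ i < δ₁)
    (hC : ∀ j, j + 1 ≤ P.m + P.K → ContinuousOn (av j).avg {U : GaugeField P j G | PlaqSmall δ₁ U}) :
    ∀ k : ℕ, k ≤ P.m + P.K →
      closure {U : GaugeField P 0 G | ∀ i, i ≤ k → PlaqSmall (ϑ i) (Averaging.iter av i U)} ⊆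
          {U : GaugeField P 0 G | ∀ i, i ≤ k → ∀ p, dist1 (GaugeField.plaqHol (Averaging.iter av i U) p) ≤ ϑ i} ∧
        ∀ U : GaugeField P 0 G, (∀ i, i ≤ k → ∀ p, dist1 (GaugeField.plaqHol (Averaging.iter av i U) p) ≤ ϑ i) →
          ContinuousAt (Averaging.iter av k) U
  | 0, _ => by
      refine ⟨?_, fun U _ => continuousAt_id⟩
      intro U hU i hi p
      obtain rfl : i = 0 := Nat.le_zero.mp hi
      have hsub : {U : GaugeField P 0 G | ∀ i, i ≤ 0 → PlaqSmall (ϑ i) (Averaging.iter av i U)} ⊆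
          {U | dist1 (GaugeField.plaqHol U p) < ϑ 0} := fun U h => h 0 le_rfl p
      have hcl := closure_mono hsub hU
      exact closure_lt_subset_le (hdist 0 p) continuous_const hcl
  | k + 1, hk => by
      obtain ⟨hcl, hca⟩ := closure_histProfile_subset_and_continuousAt hdist hopen hϑ hC k (by omega)
      have hca' : ∀ U : GaugeField P 0 G, (∀ i, i ≤ k → ∀ p, dist1 (GaugeField.plaqHol (Averaging.iter av i U) p) ≤ ϑ i) →
          ContinuousAt (Averaging.iter av (k + 1)) U := by
        intro U hU
        have hsm : PlaqSmall δ₁ (Averaging.iter av k U) := fun p => (hU k le_rfl p).trans_lt (hϑ k)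
        have h1 : ContinuousAt (av k).avg (Averaging.iter av k U) :=
          (hC k (by omega)).continuousAt ((hopen k δ₁).mem_nhds hsm)
        exact ContinuousAt.comp (g := (av k).avg) h1 (hca U hU)
      refine ⟨?_, fun U hU => hca' U fun i hi p => hU i (by omega) p⟩
      intro U hU
      have hsub0 : {U : GaugeField P 0 G | ∀ i, i ≤ k + 1 → PlaqSmall (ϑ i) (Averaging.iter av i U)} ⊆
          {U : GaugeField P 0 G | ∀ i, i ≤ k → PlaqSmall (ϑ i) (Averaging.iter av i U)} := fun W hW i hi => hW i (by omega)
      have hUk : U ∈ closure {U : GaugeField P 0 G | ∀ i, i ≤ k → PlaqSmall (ϑ i) (Averaging.iter av i U)} :=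
        closure_mono hsub0 hU
      have hCk := hcl hUk
      intro i hi p
      rcases Nat.lt_or_ge i (k + 1) with hlt | hge
      · exact hCk i (by omega) p
      · obtain rfl : i = k + 1 := le_antisymm hi hge
        have hf : ContinuousAt (fun W : GaugeField P 0 G => dist1 (GaugeField.plaqHol (Averaging.iter av (k + 1) W) p)) U :=
          (hdist (k + 1) p).continuousAt.comp (hca' U hCk)
        have hmem := hf.continuousWithinAt.mem_closure_image hU
        have hsub : (fun W : GaugeField P 0 G => dist1 (GaugeField.plaqHol (Averaging.iter av (k + 1) W) p)) ''
            {U : GaugeField P 0 G | ∀ i, i ≤ k + 1 → PlaqSmall (ϑ i) (Averaging.iter av i U)} ⊆ Set.Iic (ϑ (k + 1)) := by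
          rintro _ ⟨W, hW, rfl⟩
          exact (hW (k + 1) le_rfl p).le
        have h2 : dist1 (GaugeField.plaqHol (Averaging.iter av (k + 1) U) p) ∈ closure (Set.Iic (ϑ (k + 1))) :=
          closure_mono hsub hmem
        rw [closure_Iic] at h2
        exact h2

/-- ★★ **THE FRONTIER OF THE UV-SMALL HISTORIES LIES ON THE THRESHOLD LEVEL HYPERSURFACES**: under the same hypotheses … [cite: Balaban1985UV3, (7) p.257] -/
theorem frontier_histProfile_subset
    (hdist : ∀ (j : ℕ) (p : Plaq P j), Continuous fun U : GaugeField P j G => dist1 (GaugeField.plaqHol U p))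
    (hopen : ∀ (j : ℕ) (δ : ℝ), IsOpen {U : GaugeField P j G | PlaqSmall δ U})
    (hϑ : ∀ i, ϑ i < δ₁)
    (hC : ∀ j, j + 1 ≤ P.m + P.K → ContinuousOn (av j).avg {U : GaugeField P j G | PlaqSmall δ₁ U})
    {k : ℕ} (hk : k ≤ P.m + P.K) :
    frontier {U : GaugeField P 0 G | ∀ i, i ≤ k → PlaqSmall (ϑ i) (Averaging.iter av i U)} ⊆
      {U : GaugeField P 0 G | (∀ i, i ≤ k → ∀ p, dist1 (GaugeField.plaqHol (Averaging.iter av i U) p) ≤ ϑ i) ∧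
        ∃ i, i ≤ k ∧ ∃ p, dist1 (GaugeField.plaqHol (Averaging.iter av i U) p) = ϑ i} := by
  intro U hU
  have hSo := (isOpen_histProfile_and_continuousOn av ϑ δ₁ hopen (fun i => (hϑ i).le) hC k hk).1
  rw [hSo.frontier_eq, Set.mem_sdiff] at hU
  obtain ⟨hUcl, hUnot⟩ := hU
  have hle := (closure_histProfile_subset_and_continuousAt av ϑ δ₁ hdist hopen hϑ hC k hk).1 hUcl
  refine ⟨hle, ?_⟩
  by_contra hne
  push Not at hne
  exact hUnot fun i hi p => lt_of_le_of_ne (hle i hi p) (hne i hi p)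

end ClosedProfile

/-- ★★★ **CHART-REG REDUCTION**: the frontier of `histGood` lies on finitely many threshold level sets. [cite: Balaban1985UV3, (7) p.257] -/
theorem frontier_histGood_subset (F : T3Family) {K : ℕ} {θ : ℕ → ℝ} {δ' : ℝ} (hδ' : 0 ≤ δ') (hθ : ∀ i, θ i < δ')
    (hsmall : (((((F.P K).d + 2) * (F.P K).L : ℕ) : ℝ) ^ 2 / 4) * δ' ≤ ExpMeanLog.deltaSU (Fin 2) / 2) {n : ℕ} (h : n ≤ K) :
    frontier (histGood F ℰp θ K n) ⊆
      {U | ∃ j, j ≤ K - n ∧ ∃ p : Plaq (F.P K) j,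
        dist1 (GaugeField.plaqHol (Averaging.iter (fun i => BlockAveraging.blockAvg (P := F.P K) (j := i) ℰp) j U) p) = θ (K - j)} := by
  rw [Summit.QuantumFields.YangMills.Theorems.PosOnSmallReduction.histGood_eq_setOf_forall_le F θ h]
  have hKK : (F.P K).K = K := rfl
  have hdist : ∀ (j : ℕ) (p : Plaq (F.P K) j),
      Continuous fun U : GaugeField (F.P K) j (Matrix.specialUnitaryGroup (Fin 2) ℂ) => dist1 (GaugeField.plaqHol U p) := fun j p =>
    (UnitaryModel.continuous_opDist1.comp (Literature.MathematicalPhysics.QuantumLattice.continuous_fundamentalRep (Fin 2))).comp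
      (B12ContinuousTransportInvarianceOn.continuous_plaqHol_SU (N := 2) p)
  intro U hU
  obtain ⟨-, j, hj, p, hp⟩ := frontier_histProfile_subset (fun i => BlockAveraging.blockAvg (P := F.P K) (j := i) ℰp)
    (fun i => θ (K - i)) δ' hdist (fun j δ => Node00.isOpen_plaqSmall δ) (fun i => hθ _)
    (fun j _ => Summit.QuantumFields.YangMills.Theorems.FibrePositivity.continuousOn_blockAvg_expMeanLogSU hδ' hsmall) (by omega) hU
  exact ⟨j, hj, p, hp⟩

/-- ★★★ … and every intermediate averaging is continuous on the closure of the window. [cite: Balaban1985UV3, (7) p.257] -/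
theorem continuousAt_iter_of_mem_closure_histGood (F : T3Family) {K : ℕ} {θ : ℕ → ℝ} {δ' : ℝ} (hδ' : 0 ≤ δ') (hθ : ∀ i, θ i < δ')
    (hsmall : (((((F.P K).d + 2) * (F.P K).L : ℕ) : ℝ) ^ 2 / 4) * δ' ≤ ExpMeanLog.deltaSU (Fin 2) / 2) {n : ℕ} (h : n ≤ K)
    {U : GaugeField (F.P K) 0 (Matrix.specialUnitaryGroup (Fin 2) ℂ)} (hU : U ∈ closure (histGood F ℰp θ K n))
    {j : ℕ} (hj : j ≤ K - n) :
    ContinuousAt (Averaging.iter (fun i => BlockAveraging.blockAvg (P := F.P K) (j := i) ℰp) j) U := by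
  rw [Summit.QuantumFields.YangMills.Theorems.PosOnSmallReduction.histGood_eq_setOf_forall_le F θ h] at hU
  have hKK : (F.P K).K = K := rfl
  have hdist : ∀ (j : ℕ) (p : Plaq (F.P K) j),
      Continuous fun U : GaugeField (F.P K) j (Matrix.specialUnitaryGroup (Fin 2) ℂ) => dist1 (GaugeField.plaqHol U p) := fun j p =>
    (UnitaryModel.continuous_opDist1.comp (Literature.MathematicalPhysics.QuantumLattice.continuous_fundamentalRep (Fin 2))).comp
      (B12ContinuousTransportInvarianceOn.continuous_plaqHol_SU (N := 2) p)
  have hsub0 : {U : GaugeField (F.P K) 0 (Matrix.specialUnitaryGroup (Fin 2) ℂ) |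
      ∀ i, i ≤ K - n → PlaqSmall (θ (K - i)) (Averaging.iter (fun i => BlockAveraging.blockAvg (P := F.P K) (j := i) ℰp) i U)} ⊆
      {U | ∀ i, i ≤ j → PlaqSmall (θ (K - i)) (Averaging.iter (fun i => BlockAveraging.blockAvg (P := F.P K) (j := i) ℰp) i U)} :=
    fun W hW i hi => hW i (by omega)
  have hUj := closure_mono hsub0 hU
  obtain ⟨hcl, hca⟩ := closure_histProfile_subset_and_continuousAt (fun i => BlockAveraging.blockAvg (P := F.P K) (j := i) ℰp)
    (fun i => θ (K - i)) δ' hdist (fun j δ => Node00.isOpen_plaqSmall δ) (fun i => hθ _)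
    (fun j _ => Summit.QuantumFields.YangMills.Theorems.FibrePositivity.continuousOn_blockAvg_expMeanLogSU hδ' hsmall) j (by omega)
  exact hca U (hcl hUj)

/-- ★★★ **CHART-REG IN THE CELL'S CURRENCY** — a window chart from level-set avoidance. [cite: Balaban1985UV3, (7) p.257] -/
def WindowChart.ofLevelAvoiding (F : T3Family) {J K : ℕ} (hJK : J ≤ K) {θ : ℕ → ℝ} {δ' : ℝ} (hδ' : 0 ≤ δ') (hθ : ∀ i, θ i < δ')
    (hsmall : (((((F.P K).d + 2) * (F.P K).L : ℕ) : ℝ) ^ 2 / 4) * δ' ≤ ExpMeanLog.deltaSU (Fin 2) / 2)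
    (O : Set (GaugeField (F.P J) 0 (Matrix.specialUnitaryGroup (Fin 2) ℂ)))
    (Φ : GaugeField (F.P J) 0 (Matrix.specialUnitaryGroup (Fin 2) ℂ) × GaugeField (F.P K) 0 (Matrix.specialUnitaryGroup (Fin 2) ℂ) →
      GaugeField (F.P K) 0 (Matrix.specialUnitaryGroup (Fin 2) ℂ))
    (jac : GaugeField (F.P J) 0 (Matrix.specialUnitaryGroup (Fin 2) ℂ) × GaugeField (F.P K) 0 (Matrix.specialUnitaryGroup (Fin 2) ℂ) → ℝ≥0)
    (bound : ℝ≥0) (measurable_Φ : Measurable Φ) (measurable_jac : Measurable jac) (jac_le : ∀ p, jac p ≤ bound)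
    (descendTo_Φ : ∀ V ∈ O, ∀ z, jac (V, z) ≠ 0 → descendTo F ℰp J K hJK (Φ (V, z)) = V)
    (map_Φ : (fieldMeasure (F.P K) 0 (Matrix.specialUnitaryGroup (Fin 2) ℂ)).restrict
        (descendTo F ℰp J K hJK ⁻¹' O ∩ histGood F ℰp θ K J) =
      ((((fieldMeasure (F.P J) 0 (Matrix.specialUnitaryGroup (Fin 2) ℂ)).restrict O).prod
          (fieldMeasure (F.P K) 0 (Matrix.specialUnitaryGroup (Fin 2) ℂ))).withDensity (fun p => (jac p : ℝ≥0∞))).map Φ)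
    (levelAvoiding : ∀ V₀ ∈ O, ∀ᵐ z ∂fieldMeasure (F.P K) 0 (Matrix.specialUnitaryGroup (Fin 2) ℂ),
      (ContinuousAt (fun V => (jac (V, z) : ℝ)) V₀ ∧ ContinuousAt (fun V => Φ (V, z)) V₀ ∧
          (jac (V₀, z) ≠ 0 → ∀ j, j ≤ K - J → ∀ p : Plaq (F.P K) j,
            dist1 (GaugeField.plaqHol (Averaging.iter (fun i => BlockAveraging.blockAvg (P := F.P K) (j := i) ℰp) j (Φ (V₀, z))) p)
              ≠ θ (K - j))) ∨
        (∀ᶠ V in 𝓝 V₀, jac (V, z) = 0 ∨ Φ (V, z) ∉ histGood F ℰp θ K J))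
    (charge : ∀ V ∈ O, (∃ U, descendTo F ℰp J K hJK U = V ∧ U ∈ interior (histGood F ℰp θ K J)) →
      0 < fieldMeasure (F.P K) 0 (Matrix.specialUnitaryGroup (Fin 2) ℂ) {z | jac (V, z) ≠ 0 ∧ Φ (V, z) ∈ histGood F ℰp θ K J}) :
    WindowChart F hJK (histGood F ℰp θ K J) O where
  Φ := Φ
  jac := jac
  bound := bound
  measurable_Φ := measurable_Φ
  measurable_jac := measurable_jac
  jac_le := jac_le
  descendTo_Φ := descendTo_Φ
  map_Φ := map_Φ
  regular V₀ hV₀ := by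
    filter_upwards [levelAvoiding V₀ hV₀] with z hz
    rcases hz with ⟨h1, h2, h3⟩ | h
    · refine Or.inl ⟨h1, h2, fun hj hfr => ?_⟩
      obtain ⟨j, hj', p, hp⟩ := frontier_histGood_subset F hδ' hθ hsmall hJK hfr
      exact h3 hj j hj' p hp
    · exact Or.inr h
  charge := charge


end Summit.QuantumFields.YangMills.Theorems.FluctuationComparisonRegPrIntLWregInterior

end
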